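import Mathlib.MeasureTheory.Integral.Prod
import Mathlib.Order.Filter.AtTopBot.Basic
import Literature.Analysis.FluidPDE.PassiveScalar
import Literature.Analysis.FluidPDE.ObukhovCorrsinAnomalousDissipation
import HarnessLib

/-!
# Non-uniqueness and inadmissibility of the vanishing viscosity limit of passive scalar transport
  (Huysmans–Titi, J. Math. Pures Appl. 198 (2025) 103685, Def. 2.3, Thm. 5.8, Thm. 6.7 — faithful statements)

Topic `Analysis/FluidPDE`; the ALL-DATA, bounded-velocity companion of the lack-of-selection statements
`ColomboCrippaSorella2023_thmB/_thmC` (`ObukhovCorrsinAnomalousDissipation.lean`, one datum, Hölder fields)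
and `BCCDS2024_lackOfSelectionI/II` (`AnomalousDissipationLackOfSelection.lean`, forced Navier–Stokes), and of
the rigid side `RenormalizationNoDissipationAnomaly.lean` (Bagnara–Boutros–De Lellis–Mayboroda 2026:
renormalization PROPERTY of a field ⇒ unique limits). Vocabulary `Torus.IsWeakScalarTransportOn`,
`Torus.slabMeasure` (weak-* pairings on `(0,T) × T^d`), `FunctionSpaces.Torus.IsWeaklyDivFree`, `stLift`
reused, never redeclared. Colombo–Crippa–Sorella (Ann. PDE 2023, p. 7) cite this work as the `L^∞`
partial answer to their all-data selection problem; the tree had no typed statement.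

L. Huysmans, E. S. Titi, *Non-uniqueness & inadmissibility of the vanishing viscosity limit of the
passive scalar transport equation*, J. Math. Pures Appl. 198 (2025) 103685 (open access CC-BY; held as
`paper:doi-10-1016-j-matpur-2025-103685`, text render in 27 chunks, displays dropped by the render and
recovered from the arXiv version arXiv:2307.00809 = `paper:arxiv-2307.00809`, pp. 3–4 and p. 8;
statements checked on both 2026-08-27): §1.2 "Main results" (chunk 1) = **Theorem 5.8** (Non-unique
renormalised vanishing viscosity limit solutions; restated §5 chunk 17) and **Theorem 6.7** (Inadmissible
vanishing viscosity limit; restated §6 chunk 22); §2 **Definition 2.2** (weak solution of (TE): `u ∈ L¹L¹`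
divergence free, `f ∈ L¹L¹`, `uf ∈ L¹`, tests `C^∞_c(T^d × [0,T))`, datum term `-∫ f₀ φ₀`),
**Definition 2.3** (renormalised weak solution: `β(f)` is a weak solution with datum `β(f₀)` for every
`β ∈ C⁰_b(ℝ)`; Remark 2.5 of the arXiv version: equivalent to `β ∈ C¹` for divergence-free `u`),
Definition 2.7 ((ν-ADE) weak solutions), **Theorem 3.6** (well-posedness of (ν-ADE) for `u ∈ L^∞L^∞`:
uniqueness in `L¹L¹`, existence, `L^∞` bounds, energy identity).

## Contents

* `Torus.IsRenormalisedWeakTransportSolutionOn T u f₀ f` — **Definition 2.3** (per-solution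
  renormalisation, `β ∈ C⁰_b`), over the tree's weak class at `κ = 0`.
* `HuysmansTiti2025_thm58` — **Theorem 5.8** (named fact).
* `HuysmansTiti2025_thm67` — **Theorem 6.7** (named fact).

## Rendering and faithfulness notes

* Both theorems speak of "`f^ν` the unique solution to (ν-ADE) along `u` with initial data `f₀`"
  (unique in `L¹L¹` by Thm. 3.6 since `u` is bounded); typed over ALL weak solutions of the tree's class
  `IsWeakScalarTransportOn T ν u f₀` (`L^∞_t L²_x ⊂ L¹L¹`), which for bounded `u`, `ν > 0` and bounded `f₀`
  contains that unique solution and nothing else — no choice is involved.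
* Convergences: "weak-* in `L^∞([0,T];L^∞(T²))`" is pairing against every `φ ∈ L¹((0,T) × T²)`
  (`Torus.slabMeasure`, as in `Torus.IsScalarLimitPoint`); "strong in `L^p([0,T];L^p(T²))`" is
  `eLpNorm (· - ·) p (slabMeasure) → 0` on the stated time ranges. The `C⁰([0,42-ε];L^p)` /
  `C⁰([58+ε,100];L^p)` clauses of Thm. 6.7, the time-continuity `f ∈ C⁰_{weak-*}([0,100];L^∞)` and the
  pointwise-in-time identities "for all `t`" are rendered in the a.e.-in-time form the weak class supports
  (perfect mixing for a.e. `t ∈ (42,58)`, time symmetry `f(t) = f(100-t)` for a.e. `t`); the printed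
  endpoint statement "`f(·,100) = f₀` is perfectly unmixed" is the `t → 100` value of the weak-*
  continuous representative and is quoted, not typed (a weakening by omission; nothing strengthened).
  The arXiv version of Thm. 5.8 adds that the set of weak-* limit points is uncountable (journal:
  footnote 21, a sketch) — not typed.
* Divergence-freeness "in the distributional sense" of the bounded field is `IsWeaklyDivFree (u t)` for
  a.e. `t` (inside the weak class) and stated for the field as a hypothesis-free property of the witness.

## References

* L. Huysmans, E. S. Titi, J. Math. Pures Appl. 198 (2025) 103685 = arXiv:2307.00809, §1.2, Defs. 2.2–2.3,
  2.7, Thm. 3.6, Thm. 5.8, Thm. 6.7. [`HuysmansTiti2025`]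
* M. Colombo, G. Crippa, M. Sorella, Ann. PDE 9 (2023) 21, p. 7 (the open selection problem).
  [`ColomboCrippaSorella2023`]
-/

open MeasureTheory Set Filter
open scoped ENNReal NNReal Topology

noncomputable section

namespace Literature.Analysis.FluidPDE

open Literature.Analysis.FunctionSpaces

namespace Torus

variable {d : Type*} [Fintype d]

/-- **Renormalised weak solution of the transport equation** (Huysmans–Titi 2025, Definition 2.3, after
DiPerna–Lions): a weak solution `f` of `∂ₜf + ∇·(uf) = 0` on `T^d × [0,T)` with datum `f₀` (the tree's
`IsWeakScalarTransportOn T 0 u f₀ f`) such that for every bounded continuous `β : ℝ → ℝ` (`β ∈ C⁰_b(ℝ)`) the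
composition `β(f)` is a weak solution with datum `β(f₀)`. (Per-solution notion; the per-FIELD
"renormalization property" of Bagnara–Boutros–De Lellis–Mayboroda is `Torus.HasRenormalizationPropertyOn`.)
[cite: HuysmansTiti2025, Def. 2.3] -/
def IsRenormalisedWeakTransportSolutionOn (T : ℝ) (u : ℝ → UnitAddTorus d → EuclideanSpace ℝ d)
    (f₀ : UnitAddTorus d → ℝ) (f : ℝ → UnitAddTorus d → ℝ) : Prop :=
  IsWeakScalarTransportOn T 0 u f₀ f ∧
    ∀ β : ℝ → ℝ, Continuous β → (∃ M : ℝ, ∀ s, |β s| ≤ M) →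
      IsWeakScalarTransportOn T 0 u (fun x => β (f₀ x)) (fun t x => β (f t x))

end Torus

/-- **Huysmans–Titi 2025, Theorem 5.8 (Non-unique renormalised vanishing viscosity limit solutions)**
(JMPA 198 (2025) 103685, §1.2 and §5), verbatim (displays from arXiv:2307.00809 p. 3): "There exists a
divergence-free vector field `u ∈ L^∞([0,1]; L^∞(T²;ℝ²))`, and a sequence `{ν_n}_{n∈ℕ}` with `ν_n > 0` and
`ν_n → 0`, such that for any initial data `f₀ ∈ L^∞(T²)`, and for `f^ν` the unique solution to (ν-ADE) along
`u` with initial data `f₀`, one has `f^{ν_{2n}} → f_even`, `f^{ν_{2n+1}} → f_odd`, with the above convergence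
in weak-* `L^∞([0,1];L^∞(T²))`, and strong in `L^p([0,1];L^p(T²))` for all `p ∈ [1,∞)`. Furthermore, the
limit functions `f_even`, `f_odd` are renormalised weak solutions to (TE) along `u` with initial data `f₀`.
Moreover, if `f₀` is not constant, then `f_even ≠ f_odd`." Typed (module docstring): bounded measurable
`u` on `(0,1) × T²`, weakly divergence free at a.e. time; the convergences hold for every family
`(θ_n)` of weak solutions of the `ν_n`-problems from `f₀` (= the unique ones); `f_even ≠ f_odd` as functions
not a.e. equal on `(0,1) × T²`; "`f₀` not constant" as not a.e. equal to a constant.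
[cite: HuysmansTiti2025, Thm. 5.8] -/
def HuysmansTiti2025_thm58 : Prop :=
  ∃ (u : ℝ → UnitAddTorus (Fin 2) → EuclideanSpace ℝ (Fin 2)) (ν : ℕ → ℝ),
    MemLp (FunctionSpaces.Torus.stLift u) ∞ (volume.restrict (Ioo 0 1 ×ˢ univ)) ∧
    (∀ᵐ t ∂(volume.restrict (Ioo (0 : ℝ) 1)), FunctionSpaces.Torus.IsWeaklyDivFree (u t)) ∧
    (∀ n, 0 < ν n) ∧ Tendsto ν atTop (𝓝 0) ∧
    ∀ f₀ : UnitAddTorus (Fin 2) → ℝ, MemLp f₀ ∞ volume →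
      ∃ fe fo : ℝ → UnitAddTorus (Fin 2) → ℝ,
        -- the limits are renormalised weak solutions of (TE) from `f₀`
        Torus.IsRenormalisedWeakTransportSolutionOn 1 u f₀ fe ∧
        Torus.IsRenormalisedWeakTransportSolutionOn 1 u f₀ fo ∧
        -- along `ν_{2n}` (resp. `ν_{2n+1}`) the solutions converge to `f_even` (resp. `f_odd`),
        -- weak-* in `L^∞((0,1) × T²)` and strongly in every `L^p((0,1) × T²)`, `p < ∞`
        (∀ θ : ℕ → ℝ → UnitAddTorus (Fin 2) → ℝ, (∀ n, Torus.IsWeakScalarTransportOn 1 (ν n) u f₀ (θ n)) →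
          (∀ φ : ℝ × UnitAddTorus (Fin 2) → ℝ, Integrable φ (Torus.slabMeasure (Fin 2) 1) →
            Tendsto (fun n => ∫ z, Function.uncurry (θ (2 * n)) z * φ z ∂(Torus.slabMeasure (Fin 2) 1)) atTop
              (𝓝 (∫ z, Function.uncurry fe z * φ z ∂(Torus.slabMeasure (Fin 2) 1))) ∧
            Tendsto (fun n => ∫ z, Function.uncurry (θ (2 * n + 1)) z * φ z ∂(Torus.slabMeasure (Fin 2) 1)) atTop
              (𝓝 (∫ z, Function.uncurry fo z * φ z ∂(Torus.slabMeasure (Fin 2) 1)))) ∧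
          (∀ p : ℝ≥0∞, 1 ≤ p → p < ∞ →
            Tendsto (fun n => eLpNorm (Function.uncurry (θ (2 * n)) - Function.uncurry fe) p
              (Torus.slabMeasure (Fin 2) 1)) atTop (𝓝 0) ∧
            Tendsto (fun n => eLpNorm (Function.uncurry (θ (2 * n + 1)) - Function.uncurry fo) p
              (Torus.slabMeasure (Fin 2) 1)) atTop (𝓝 0))) ∧
        -- non-uniqueness: for non-constant data the two limits differ
        ((¬ ∃ c : ℝ, f₀ =ᵐ[volume] fun _ => c) →
          ¬ (Function.uncurry fe =ᵐ[Torus.slabMeasure (Fin 2) 1] Function.uncurry fo))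

/-- **Huysmans–Titi 2025, Theorem 6.7 (Inadmissible vanishing viscosity limit)** (JMPA 198 (2025) 103685,
§1.2 and §6), verbatim (displays from arXiv:2307.00809 pp. 3–4): "There exists a divergence-free vector
field `u ∈ L^∞([0,100]; L^∞(T²;ℝ²))`, such that for any initial data `f₀ ∈ L^∞(T²)`, and for `f^ν` the
unique solution to (ν-ADE) along `u` with initial data `f₀`, one has `f^ν → f` (`ν → 0`), with the above
convergence in weak-* `L^∞([0,100];L^∞(T²))`, strong in `L^p([0,42];L^p(T²))`, `C⁰([0,42-ε];L^p(T²))`,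
`L^p([58,100];L^p(T²))`, and `C⁰([58+ε,100];L^p(T²))` for all `p ∈ [1,∞)`, and all `ε > 0`. The limit
function `f ∈ C⁰_{weak-*}([0,100];L^∞(T²))` is a weak solution to (TE) along `u` with initial data `f₀`.
Moreover, for all `t ∈ [42,58]`, `f(·,t) ≡ ∫_{T²} f₀(y) dy`, is perfectly mixed to its spatial average.
Furthermore, for all `t ∈ [0,100]`, `f(·,t) = f(·,100-t)` and in particular, `f(·,100) = f₀`, is perfectly
unmixed. In particular, if `f₀` is not constant, any `L^p(T²)` norms of `f(·,t)` (for `p ∈ (1,∞]`)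
increase after `t = 58`, contrary to the entropy-admissibility criterion of Dafermos in [20]." Typed
(module docstring): bounded measurable weakly divergence-free `u` on `(0,100) × T²`; for every bounded
`f₀` a weak transport solution `f` from `f₀` on `[0,100)` such that every family `(θ_ν)_{ν>0}` of weak
solutions of the `ν`-problems converges to `f` as `ν → 0⁺` weak-* on `(0,100) × T²` and strongly in `L^p`
on `(0,42) × T²` and on `(58,100) × T²` (`p < ∞`); `f(t) ≡ ∫ f₀` for a.e. `t ∈ (42,58)`; and
`f(t) = f(100 - t)` (a.e. in space) for a.e. `t ∈ (0,100)`. The `C⁰_t L^p_x` clauses, the weak-* time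
continuity and the endpoint value `f(·,100) = f₀` are quoted, not typed. [cite: HuysmansTiti2025, Thm. 6.7] -/
def HuysmansTiti2025_thm67 : Prop :=
  ∃ u : ℝ → UnitAddTorus (Fin 2) → EuclideanSpace ℝ (Fin 2),
    MemLp (FunctionSpaces.Torus.stLift u) ∞ (volume.restrict (Ioo 0 100 ×ˢ univ)) ∧
    (∀ᵐ t ∂(volume.restrict (Ioo (0 : ℝ) 100)), FunctionSpaces.Torus.IsWeaklyDivFree (u t)) ∧
    ∀ f₀ : UnitAddTorus (Fin 2) → ℝ, MemLp f₀ ∞ volume →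
      ∃ f : ℝ → UnitAddTorus (Fin 2) → ℝ,
        Torus.IsWeakScalarTransportOn 100 0 u f₀ f ∧
        -- `f^ν → f` as `ν → 0⁺`: weak-* on `(0,100) × T²`, strongly in `L^p` on `(0,42)` and `(58,100)`
        (∀ θ : ℝ → ℝ → UnitAddTorus (Fin 2) → ℝ,
          (∀ ν, 0 < ν → Torus.IsWeakScalarTransportOn 100 ν u f₀ (θ ν)) →
          (∀ φ : ℝ × UnitAddTorus (Fin 2) → ℝ, Integrable φ (Torus.slabMeasure (Fin 2) 100) →
            Tendsto (fun ν => ∫ z, Function.uncurry (θ ν) z * φ z ∂(Torus.slabMeasure (Fin 2) 100))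
              (𝓝[>] (0 : ℝ)) (𝓝 (∫ z, Function.uncurry f z * φ z ∂(Torus.slabMeasure (Fin 2) 100)))) ∧
          (∀ p : ℝ≥0∞, 1 ≤ p → p < ∞ →
            Tendsto (fun ν => eLpNorm (Function.uncurry (θ ν) - Function.uncurry f) p
              (((volume : Measure ℝ).restrict (Ioo 0 42)).prod volume)) (𝓝[>] (0 : ℝ)) (𝓝 0) ∧
            Tendsto (fun ν => eLpNorm (Function.uncurry (θ ν) - Function.uncurry f) p
              (((volume : Measure ℝ).restrict (Ioo 58 100)).prod volume)) (𝓝[>] (0 : ℝ)) (𝓝 0))) ∧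
        -- perfectly mixed on `[42,58]`: `f(t) ≡ ∫ f₀`
        (∀ᵐ t ∂(volume.restrict (Ioo (42 : ℝ) 58)), f t =ᵐ[volume] fun _ => ∫ y, f₀ y) ∧
        -- time symmetry `f(t) = f(100 - t)` (perfect unmixing back to `f₀` at `t = 100`)
        (∀ᵐ t ∂(volume.restrict (Ioo (0 : ℝ) 100)), f t =ᵐ[volume] f (100 - t))

end Literature.Analysis.FluidPDE

end
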